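import Literature.NumberTheory.LFunctions.YoshidaWindowGramColumnData
import HarnessLib

/-!
# C∞ rung `R1E` (even sector) — DATA `PbbL2` part 1/1

Route context: Fourier–Galerkin / Schur-complement certificates of Weil positivity on a window ("format C", C∞ door `weilPositivityOn_of_cinf_pipeline`); supporting stmt-RiemannHypothesis-0098; seat rh-explicit-weil-2 (`cinfemit.py`/`emit_lean2.py`, HOME/rh-explicit-weil-2/gen17/EMITTER-PHASE2.md). Data / bookkeeping only; standard axioms; no RH claim.
-/

set_option autoImplicit false
-- `Summit.RiemannHypothesis.RiemannHypothesis.…` is the layout-mandated namespace (summit = problem name).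
set_option linter.dupNamespace false

namespace Summit.RiemannHypothesis.RiemannHypothesis.Theorems.WeilFormatC

open Literature.NumberTheory.LFunctions

namespace CinfR1E

/-- Packed rows part 1/1 of table `PbbL2` (word width 248, 4 words). -/
def PbbL2_P : List ℕ := [
  0x7fe649af850a2387ff9ccc072b0224bef4eff12de0878c015199dbbff3e668806281c376aca42e9448083564ed42be3932dc4e90d4866eb4500d71f16315809aef67c93ec2bb13ab6e3a820990bf2ef41bf26311c4dcccdee6703bd6fc9f440ed8e935965da517387b9e3ac1bc3d5ae9f1dc398e8fd0dca9544ab205,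
  0x842d0468493a9b8279fede7cfc7fad8e4d9b1889772cb3efb9cbf227a183a180c3a2440e6b5857d5f3121deb9410d42e86a08a53674a13a2a278c15add579b5ac09cbcdb5ba820c2c42d81b18fa631e4e153f6691330bdbff212a75ee1809aef67c93ec2bb13ab6e3a820990bf2ef41bf26311c4dcccdee8bdb481f9,
  0x82379d17a6e6460f3d45bbe4f045662e3d94e1d4684fd42a438a1197f32a46a05351ccc500bd2a0f6793e86257c3d57fecf86fc8f54020c6816aef0ea3a380c3a2440e6b5857d5f3121deb9410d42e86a08a53674a13a35bb02768dd0f806281c376aca42e9448083564ed42be3932dc4e90d4866eb3f12813471da9,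
  0x9dadeee8d1e08ac0fa5f18dbb441454928067c36c89e1273f6cc37d49c066482379d17a6e6460f3d45bbe4f045662e3d94e1d4684fd40fda6b619cf675ef842d0468493a9b8279fede7cfc7fad8e4d9b1889772cb3d3cc309e742417767fe649af850a2387ff9ccc072b0224bef4eff12de0878c0fa5d9e715faf672]

end CinfR1E

end Summit.RiemannHypothesis.RiemannHypothesis.Theorems.WeilFormatC
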